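import Summits.AnomalousDissipation.AnomalousDissipation.Theses.TwoAndHalfD
import Summits.AnomalousDissipation.AnomalousDissipation.Theorems.TwoAndHalfDScalarAnomalySteadySourceFormalColdStartVarianceToolkit
import Literature.Analysis.FluidPDE.PassiveScalarWellPosednessProofs
import Literature.Analysis.FluidPDE.PassiveScalarClassicalEnergy
import Literature.Analysis.FluidPDE.TorusHeatForcedIcc

/-!
# S2 `stub_coldStartVariance`: the cold-start variance bound by continuous restarts

Stub S2 of the line `budgeted-mixer-template` for the crux
`Summit.AnomalousDissipation.AnomalousDissipation.Theses.TwoAndHalfD.ScalarAnomalySteadySourceFormal`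
(stmt-AnomalousDissipation-0448); the statement is registered verbatim in the line's checked
skeleton (`Cruxes/ScalarAnomalySteadySourceFormal/Lines/budgeted-mixer-template.lean`) and is
consumed by the kernel-checked composition `ScalarAnomalySteadySourceFormal_of` there.

CONTENT. For `κ > 0`, `τ > 0`, a jointly smooth divergence-free drift `u` on `T² × [0, ∞)`, a
smooth profile `h` and a class `S` of profiles with (Half) "every classical release on
`[s, s + τ]`, `s ≥ 0`, with datum in `S` halves in `L²`-norm-squared twice over (`≤ ¼`)" and
(Inv-h) "every global classical cold start of the `h`-sourced problem stays in `S`":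

* `exists_release` — classical unforced solutions on `[s, s + τ]` from a smooth datum at `s`
  (tree existence `Torus.exists_isClassicalScalarTransportForcedOn` after the time shift
  `u(· + s)`, `Torus.timeDerivWithin_comp_add_const`);
* `exists_global_coldStart` — a global classical solution of `∂ₜθ + u·∇θ = κΔθ + h` on `[0, ∞)`
  with `θ(0) = 0`, glued from the tree's unique solutions on `[0, N + 1]`
  (`IsClassicalScalarTransportForcedOn.eq_on_Icc`; smoothness and the one-sided time derivative
  are local);
* `stub_coldStartVariance` — the bound `‖θ(t)‖²_{L²} ≤ 4τ²‖h‖²_{L²}`, `t ≥ 0`, by continuous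
  restarts: `‖θ(s + τ)‖ ≤ ½‖θ(s)‖ + τ‖h‖` (release halves, cold-start remainder grows at most
  like `τ‖h‖` by the toolkit's `sqrt_scalarL2Sq_le_of_coldStart`, Minkowski) and `‖θ‖ ≤ τ‖h‖` on
  `[0, τ]`, so `sup_t ‖θ(t)‖ ≤ 2τ‖h‖`.

The linear-PDE plumbing (restriction, linearity, sourced `L²` balance, Cauchy–Schwarz /
Minkowski, cold-start estimate) is the toolkit file
`TwoAndHalfDScalarAnomalySteadySourceFormalColdStartVarianceToolkit`.
Supports stmt-AnomalousDissipation-0448. [folklore: Shaw–Thiffeault–Doering 2007 (I.11)]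
-/

-- the summit path `AnomalousDissipation/AnomalousDissipation` duplicates a namespace component
set_option linter.dupNamespace false

noncomputable section

namespace Summit.AnomalousDissipation.AnomalousDissipation.Theorems.ScalarAnomalySteadySourceFormal.ColdStartVariance

open MeasureTheory Filter Topology Set
open scoped ENNReal NNReal InnerProductSpace ContDiff
open Literature.Analysis.FunctionSpaces Literature.Analysis.FluidPDE

variable {d : Type*} [Fintype d] [DecidableEq d]

/-! ## Releases at a later time and the global cold start -/

section Existence

variable {κ : ℝ} {u : ℝ → UnitAddTorus d → EuclideanSpace ℝ d}

/-- **Releases at time `s ≥ 0`.** For `κ > 0`, `τ > 0`, a drift jointly smooth and divergence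
free on `[0, ∞) × T^d` and a smooth datum `ψ`, there is a classical solution `φ` of the unforced
equation `∂ₜφ + u·∇φ = κΔφ` on `[s, s + τ]` with `φ(s) = ψ`: apply the tree's existence theorem
`Torus.exists_isClassicalScalarTransportForcedOn` (source `0`) on `[0, τ]` to the time-shifted
drift `u(· + s)` and shift the solution back (`Torus.timeDerivWithin_comp_add_const`). [folklore] -/
theorem exists_release {τ s : ℝ} {ψ : UnitAddTorus d → ℝ} (hκ : 0 < κ) (hτ : 0 < τ)
    (hu : Torus.IsSmoothSpaceTimeOn (Ici 0) u) (hdiv : ∀ t ∈ Ici (0 : ℝ), Torus.IsDivFree (u t))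
    (hs : 0 ≤ s) (hψ : Torus.IsSmooth ψ) :
    ∃ φ : ℝ → UnitAddTorus d → ℝ,
      Torus.IsClassicalScalarTransportOn (Icc s (s + τ)) κ u φ ∧ φ s = ψ := by
  -- the shifted drift on `[0, τ]`
  have hu' : Torus.IsSmoothSpaceTimeOn (Icc 0 τ) (fun t => u (t + s)) :=
    (hu.comp_add_const s).mono fun t ht => show 0 ≤ t + s from add_nonneg ht.1 hs
  have hdiv' : ∀ t ∈ Icc 0 τ, Torus.IsDivFree ((fun t => u (t + s)) t) := fun t ht =>
    hdiv (t + s) (show 0 ≤ t + s from add_nonneg ht.1 hs)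
  have h0 : Torus.IsSmoothSpaceTimeOn (Icc 0 τ) (fun (_ : ℝ) (_ : UnitAddTorus d) => (0 : ℝ)) :=
    Torus.isSmoothSpaceTimeOn_const (Torus.isSmooth_const _) _
  obtain ⟨φ', hφ', hφ'0⟩ :=
    Torus.exists_isClassicalScalarTransportForcedOn hκ hτ hu' hdiv' h0 hψ
  have hpre : (· + -s) ⁻¹' Icc 0 τ = Icc s (s + τ) := by
    rw [Torus.preimage_add_const_Icc']
    congr 1 <;> ring
  refine ⟨fun t => φ' (t + -s), ⟨hu.mono fun t ht => hs.trans ht.1, ?_, fun t ht x => ?_,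
    fun t ht => hdiv t (hs.trans ht.1)⟩, ?_⟩
  · have h := hφ'.smooth_scalar.comp_add_const (-s)
    rwa [hpre] at h
  · have h1 := Torus.timeDerivWithin_comp_add_const (Icc 0 τ) φ' (-s) t x
    rw [hpre] at h1
    rw [h1]
    have ht' : t + -s ∈ Icc 0 τ := ⟨by linarith [ht.1], by linarith [ht.2]⟩
    have h2 := hφ'.transport (t + -s) ht' x
    rw [neg_add_cancel_right, add_zero] at h2
    exact h2
  · funext x
    simp [hφ'0]

/-- **The global cold start.** For `κ > 0`, a drift jointly smooth and divergence free on
`[0, ∞) × T^d` and a smooth steady source `h`, there is a classical solution `θ` of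
`∂ₜθ + u·∇θ = κΔθ + h` on `[0, ∞) × T^d` with `θ(0) = 0`: the tree's unique classical solutions
on `[0, N + 1]` (`Torus.exists_isClassicalScalarTransportForcedOn`, uniqueness
`IsClassicalScalarTransportForcedOn.eq_on_Icc`) are pairwise compatible, and the glued field
`θ(t) = θ_{⌊t⌋}(t)` is a classical solution on `[0, ∞)` because joint smoothness is local
(Mathlib `contDiffOn_of_locally_contDiffOn`) and the one-sided time derivative within `[0, ∞)`
at `t < N + 1` only sees `[0, N + 1)` (continuation argument, Robinson–Rodrigo–Sadowski 2016,
§8.1). [folklore] -/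
theorem exists_global_coldStart {hsrc : UnitAddTorus d → ℝ} (hκ : 0 < κ)
    (hu : Torus.IsSmoothSpaceTimeOn (Ici 0) u) (hdiv : ∀ t ∈ Ici (0 : ℝ), Torus.IsDivFree (u t))
    (hh : Torus.IsSmooth hsrc) :
    ∃ θ : ℝ → UnitAddTorus d → ℝ,
      Torus.IsClassicalScalarTransportForcedOn (Ici 0) κ u (fun _ => hsrc) θ ∧
        θ 0 = fun _ => 0 := by
  -- the solutions on `[0, N + 1]`
  have hsol : ∀ N : ℕ, ∃ θN : ℝ → UnitAddTorus d → ℝ,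
      Torus.IsClassicalScalarTransportForcedOn (Icc 0 ((N : ℝ) + 1)) κ u (fun _ => hsrc) θN ∧
        θN 0 = fun _ => 0 := by
    intro N
    have hN : (0 : ℝ) < N + 1 := by positivity
    exact Torus.exists_isClassicalScalarTransportForcedOn hκ hN (hu.mono Icc_subset_Ici_self)
      (fun t ht => hdiv t (Icc_subset_Ici_self ht)) (Torus.isSmoothSpaceTimeOn_const hh _)
      (Torus.isSmooth_const _)
  choose Θ hΘ hΘ0 using hsol
  -- compatibility by uniqueness
  have hagree : ∀ N M : ℕ, N ≤ M → ∀ t ∈ Icc (0 : ℝ) (N + 1), Θ N t = Θ M t := by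
    intro N M hNM t ht
    have hN : (0 : ℝ) < N + 1 := by positivity
    have hsub : Icc (0 : ℝ) (N + 1) ⊆ Icc 0 (M + 1) :=
      Icc_subset_Icc le_rfl (by exact_mod_cast Nat.succ_le_succ hNM)
    exact Torus.IsClassicalScalarTransportForcedOn.eq_on_Icc hκ hN (hΘ N)
      (forced_restrict (hΘ M) hsub (uniqueDiffOn_Icc hN)) ((hΘ0 N).trans (hΘ0 M).symm) t ht
  -- the glued field
  set θ : ℝ → UnitAddTorus d → ℝ := fun t => Θ ⌊t⌋₊ t with hθ_def
  have hθeq : ∀ N : ℕ, ∀ t ∈ Icc (0 : ℝ) (N + 1), θ t = Θ N t := by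
    intro N t ht
    rcases le_total ⌊t⌋₊ N with hle | hle
    · exact hagree _ _ hle t ⟨ht.1, (Nat.lt_floor_add_one t).le⟩
    · exact (hagree _ _ hle t ht).symm
  have hθ0 : θ 0 = fun _ => 0 := by
    change Θ ⌊(0 : ℝ)⌋₊ 0 = fun _ => 0
    rw [Nat.floor_zero]
    exact hΘ0 0
  refine ⟨θ, ⟨hu, Torus.isSmoothSpaceTimeOn_const hh _, ?_, fun t ht x => ?_, hdiv⟩, hθ0⟩
  · -- joint smoothness is local
    refine contDiffOn_of_locally_contDiffOn fun z hz => ?_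
    obtain ⟨t, y⟩ := z
    set N : ℕ := ⌊t⌋₊ with hN_def
    refine ⟨Iio ((N : ℝ) + 1) ×ˢ univ, isOpen_Iio.prod isOpen_univ,
      ⟨Nat.lt_floor_add_one t, mem_univ _⟩, ?_⟩
    have hset : (Ici (0 : ℝ) ×ˢ (univ : Set (EuclideanSpace ℝ d))) ∩ Iio ((N : ℝ) + 1) ×ˢ univ ⊆
        Icc 0 ((N : ℝ) + 1) ×ˢ univ := by
      rw [prod_inter_prod, inter_self]
      exact prod_mono (fun τ hτ => ⟨hτ.1, le_of_lt hτ.2⟩) subset_rfl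
    refine (ContDiffOn.mono (hΘ N).smooth_scalar hset).congr fun z hz => ?_
    obtain ⟨τ, y'⟩ := z
    have hτ : τ ∈ Icc (0 : ℝ) (N + 1) := ⟨hz.1.1, le_of_lt hz.2.1⟩
    simp only [Torus.stLift_apply]
    rw [hθeq N τ hτ]
  · -- the equation at `t ≥ 0`: compare with `Θ N` on `[0, N + 1)`, `N = ⌊t⌋`
    set N : ℕ := ⌊t⌋₊ with hN_def
    have htlt : t < (N : ℝ) + 1 := Nat.lt_floor_add_one t
    have htN : t ∈ Icc (0 : ℝ) (N + 1) := ⟨ht, htlt.le⟩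
    have hD : Torus.timeDerivWithin (Ici 0) θ t x =
        Torus.timeDerivWithin (Icc 0 ((N : ℝ) + 1)) (Θ N) t x := by
      have h1 : HasDerivWithinAt (fun τ => Θ N τ x)
          (Torus.timeDerivWithin (Icc 0 ((N : ℝ) + 1)) (Θ N) t x) (Icc 0 ((N : ℝ) + 1)) t :=
        (hΘ N).smooth_scalar.hasDerivWithinAt_slice htN x
      have h2 : HasDerivWithinAt (fun τ => θ τ x)
          (Torus.timeDerivWithin (Icc 0 ((N : ℝ) + 1)) (Θ N) t x) (Ico 0 ((N : ℝ) + 1)) t :=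
        (h1.mono Ico_subset_Icc_self).congr
          (fun τ hτ => by rw [hθeq N τ (Ico_subset_Icc_self hτ)]) (by rw [hθeq N t htN])
      have hmem : Ico (0 : ℝ) ((N : ℝ) + 1) ∈ 𝓝[Ici 0] t := by
        rw [← Ici_inter_Iio]
        exact inter_mem_nhdsWithin _ (Iio_mem_nhds htlt)
      exact (h2.mono_of_mem_nhdsWithin hmem).derivWithin (uniqueDiffOn_Ici 0 t ht)
    rw [hD, hθeq N t htN]
    exact (hΘ N).transport t htN x

end Existence

/-! ## The stub: cold-start variance bound by continuous restarts -/

/-- **S2 `stub_coldStartVariance` (line `budgeted-mixer-template`, crux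
`TwoAndHalfD.ScalarAnomalySteadySourceFormal`).** Let `κ > 0`, `τ > 0`, `u` a jointly smooth
divergence-free drift on `T² × [0, ∞)`, `h` a smooth profile and `S` a class of profiles such that
(Half) every classical release `∂ₜφ + u·∇φ = κΔφ` on `[s, s + τ]`, `s ≥ 0`, with `φ(s) ∈ S` has
`‖φ(s + τ)‖² ≤ ¼‖φ(s)‖²`, and (Inv-h) every global classical cold start of the `h`-sourced
problem stays in `S`. Then the cold start exists globally — a classical solution `θ` of
`∂ₜθ + u·∇θ = κΔθ + h` on `[0, ∞)` with `θ(0) = 0` (`exists_global_coldStart`) — and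
`‖θ(t)‖²_{L²} ≤ 4τ²‖h‖²_{L²}` for all `t ≥ 0`. Proof by CONTINUOUS restarts: on `[0, τ]` the
cold-start estimate gives `‖θ(t)‖ ≤ τ‖h‖`; for `s ≥ 0` split `θ = φ + ρ` on `[s, s + τ]` with `φ`
the release from `θ(s) ∈ S` (`exists_release`, Inv-h) and `ρ = θ - φ` the cold start at `s`
(`forced_sub_unforced`), so that (Half), the cold-start estimate and Minkowski give
`‖θ(s + τ)‖ ≤ ½‖θ(s)‖ + τ‖h‖`; by induction on `⌊t/τ⌋`, `‖θ(t)‖ ≤ 2τ‖h‖` for all `t ≥ 0`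
(restarting only at the grid points `kτ` would give the constant `9`, not `4`). Honest at every
fixed `κ` (no limsup); the variance clause (v) of the crux in the composition
`ScalarAnomalySteadySourceFormal_of` (Shaw–Thiffeault–Doering 2007, (I.11); card P1
`DecayGivesBoundedVariance` / lp-flux 3b). [folklore] -/
theorem stub_coldStartVariance :
    ∀ (κ τ : ℝ) (u : ℝ → UnitAddTorus (Fin 2) → EuclideanSpace ℝ (Fin 2))
      (h : UnitAddTorus (Fin 2) → ℝ) (S : Set (UnitAddTorus (Fin 2) → ℝ)),
      0 < κ → 0 < τ →
      Torus.IsSmoothSpaceTimeOn (Set.Ici 0) u → (∀ t ∈ Set.Ici (0 : ℝ), Torus.IsDivFree (u t)) →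
      Torus.IsSmooth h →
      (∀ (s : ℝ), 0 ≤ s → ∀ φ : ℝ → UnitAddTorus (Fin 2) → ℝ,
          Torus.IsClassicalScalarTransportOn (Set.Icc s (s + τ)) κ u φ → φ s ∈ S →
          Torus.scalarL2Sq (φ (s + τ)) ≤ 4⁻¹ * Torus.scalarL2Sq (φ s)) →
      (∀ (θ : ℝ → UnitAddTorus (Fin 2) → ℝ),
          Torus.IsClassicalScalarTransportForcedOn (Set.Ici 0) κ u (fun _ => h) θ →
          θ 0 = (fun _ => (0 : ℝ)) → ∀ t, 0 ≤ t → θ t ∈ S) →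
      ∃ θ : ℝ → UnitAddTorus (Fin 2) → ℝ,
        Torus.IsClassicalScalarTransportForcedOn (Set.Ici 0) κ u (fun _ => h) θ ∧
        θ 0 = (fun _ => (0 : ℝ)) ∧
        ∀ t, 0 ≤ t → Torus.scalarL2Sq (θ t) ≤ 4 * τ ^ 2 * Torus.scalarL2Sq h := by
  intro κ τ u h S hκ hτ hu hdiv hh hHalf hInv
  obtain ⟨θ, hθ, hθ0⟩ := exists_global_coldStart hκ hu hdiv hh
  refine ⟨θ, hθ, hθ0, ?_⟩
  have hS : ∀ t, 0 ≤ t → θ t ∈ S := hInv θ hθ hθ0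
  set H : ℝ := √(Torus.scalarL2Sq h) with hH_def
  set a : ℝ → ℝ := fun t => √(Torus.scalarL2Sq (θ t)) with ha_def
  have hH : 0 ≤ H := Real.sqrt_nonneg _
  -- (i) the first window `[0, τ]`: `‖θ(t)‖ ≤ t‖h‖ ≤ τ‖h‖`
  have h1 : ∀ t ∈ Icc 0 τ, a t ≤ τ * H := by
    intro t ht
    have hθ' := forced_restrict hθ Icc_subset_Ici_self (uniqueDiffOn_Icc hτ)
    have hest := sqrt_scalarL2Sq_le_of_coldStart hκ.le hτ hθ' hθ0 ht
    rw [sub_zero] at hest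
    exact hest.trans (mul_le_mul_of_nonneg_right ht.2 hH)
  -- (ii) one restart: `‖θ(s + τ)‖ ≤ ½‖θ(s)‖ + τ‖h‖` for every `s ≥ 0`
  have h2 : ∀ s, 0 ≤ s → a (s + τ) ≤ a s / 2 + τ * H := by
    intro s hs
    have hsτ : s < s + τ := lt_add_of_pos_right s hτ
    have hsub : Icc s (s + τ) ⊆ Ici 0 := fun t ht => hs.trans ht.1
    have hθ' := forced_restrict hθ hsub (uniqueDiffOn_Icc hsτ)
    have hθs : Torus.IsSmooth (θ s) := hθ.smooth_scalar.isSmooth_slice (show (0 : ℝ) ≤ s from hs)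
    obtain ⟨φ, hφ, hφs⟩ := exists_release hκ hτ hu hdiv hs hθs
    -- the cold-start remainder `ρ = θ - φ`
    have hρ := forced_sub_unforced (uniqueDiffOn_Icc hsτ) hθ' hφ
    have hρ0 : (fun t x => θ t x - φ t x) s = fun _ => 0 := by
      funext x
      simp [hφs]
    have hρest := sqrt_scalarL2Sq_le_of_coldStart hκ.le hsτ hρ hρ0 (right_mem_Icc.2 hsτ.le)
    rw [add_sub_cancel_left] at hρest
    -- the release halves
    have hhalf := hHalf s hs φ hφ (hφs ▸ hS s hs)
    rw [hφs] at hhalf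
    have hφest : √(Torus.scalarL2Sq (φ (s + τ))) ≤ a s / 2 := by
      calc √(Torus.scalarL2Sq (φ (s + τ)))
          ≤ √(4⁻¹ * Torus.scalarL2Sq (θ s)) := Real.sqrt_le_sqrt hhalf
        _ = a s / 2 := by
          rw [Real.sqrt_mul' _ (Torus.scalarL2Sq_nonneg _),
            show (4⁻¹ : ℝ) = (2⁻¹) ^ 2 by norm_num, Real.sqrt_sq (by norm_num)]
          simp only [ha_def]
          ring
    -- Minkowski
    have hφt : Torus.IsSmooth (φ (s + τ)) :=
      hφ.smooth_scalar.isSmooth_slice (right_mem_Icc.2 hsτ.le)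
    have hρt : Torus.IsSmooth (fun x => θ (s + τ) x - φ (s + τ) x) :=
      hρ.smooth_scalar.isSmooth_slice (right_mem_Icc.2 hsτ.le)
    have hmink := sqrt_integral_add_sq_le hφt.continuous hρt.continuous
    have hsum : (fun x => (φ (s + τ) x + (θ (s + τ) x - φ (s + τ) x)) ^ 2) =
        fun x => θ (s + τ) x ^ 2 := by
      funext x
      rw [add_sub_cancel]
    rw [hsum] at hmink
    calc a (s + τ) = √(∫ x, θ (s + τ) x ^ 2) := rfl
      _ ≤ √(∫ x, φ (s + τ) x ^ 2) + √(∫ x, (θ (s + τ) x - φ (s + τ) x) ^ 2) := hmink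
      _ ≤ a s / 2 + τ * H := add_le_add hφest hρest
  -- (iii) induction on the number of windows
  have h3 : ∀ k : ℕ, ∀ t, 0 ≤ t → t ≤ (k + 1) * τ → a t ≤ 2 * τ * H := by
    intro k
    induction k with
    | zero =>
      intro t ht0 ht1
      have := h1 t ⟨ht0, by simpa using ht1⟩
      nlinarith [mul_nonneg hτ.le hH]
    | succ k ih =>
      intro t ht0 ht1
      by_cases hlt : t ≤ (k + 1) * τ
      · exact ih t ht0 hlt
      · have hlt : ((k : ℝ) + 1) * τ < t := lt_of_not_ge hlt
        have hk0 : (0 : ℝ) ≤ (k + 1) * τ := by positivity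
        have hs0 : 0 ≤ t - τ := by nlinarith
        have hs1 : t - τ ≤ (k + 1) * τ := by
          push_cast at ht1
          linarith
        have hstep := h2 (t - τ) hs0
        rw [sub_add_cancel] at hstep
        have := ih (t - τ) hs0 hs1
        linarith
  -- conclusion
  intro t ht
  have hk : t ≤ (⌊t / τ⌋₊ + 1) * τ := by
    have := (Nat.lt_floor_add_one (t / τ)).le
    rwa [div_le_iff₀ hτ] at this
  have hat := h3 ⌊t / τ⌋₊ t ht hk
  have ha0 : 0 ≤ a t := Real.sqrt_nonneg _
  have hsq : Torus.scalarL2Sq (θ t) = a t ^ 2 := (Real.sq_sqrt (Torus.scalarL2Sq_nonneg _)).symm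
  have hH2 : Torus.scalarL2Sq h = H ^ 2 := (Real.sq_sqrt (Torus.scalarL2Sq_nonneg _)).symm
  rw [hsq, hH2]
  nlinarith

end Summit.AnomalousDissipation.AnomalousDissipation.Theorems.ScalarAnomalySteadySourceFormal.ColdStartVariance

end
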